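import Summits.ABC.ABC.Theorems.CuspFieldPencilGoldenFromNFPencil
import Summits.ABC.ABC.Theorems.CuspFieldPencilNFPencilThreeForms
import Summits.ABC.ABC.Theorems.CuspFieldPencilNFPencilOfScoones
import Summits.ABC.ABC.Theorems.GaussianTwoDivisionOfNFPencil
import Literature.Barriers.ABC.BakerMethodBounds
import Mathlib.NumberTheory.Padics.PadicIntegers
import HarnessLib

/-!
# Sketch (stub-ideation k=1, GEN 2): helper statements for `stub_conjugateCuspTriple`
(crux stmt-ABC-26026 `GoldenCuspShadow`, route CuspFieldPencil).  Self-contained (restates the gen-1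
`Sig` / `ThreeFormsNF` verbatim so it does not import a Cruxes/ workfile).  Statements + cheap algebra
proved; the NF lemma and the P-form arithmetic are `sorry` (prover work).  Not a Theorems file.
-/

set_option linter.dupNamespace false

namespace Summit.ABC.ABC.Cruxes.GoldenCuspShadow.SideaK1G2

open NumberField UniqueFactorizationMonoid UniqueFactorizationDomain QuadraticAlgebra Literature.Barriers.ABC
open Summit.ABC.ABC.Theorems (GoldenField.golden_fact GoldenField.numberField GoldenField.isIntegral_omega
  GoldenField.finrank_eq_two GoldenField.ringOfIntegers_isPrincipalIdealRing)

/-! ## 0. The registered stub and the gen-1 door (verbatim copies of k1's `Sig`, `ThreeFormsNF`) -/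

/-- The registered stub signature, verbatim. -/
def Sig : Prop :=
  ∀ ε : ℝ, 0 < ε → ∃ κ : ℝ, ∀ u w : ℤ, IsCoprime u w → u * w * (u ^ 2 - 11 * u * w - w ^ 2) ≠ 0 → Real.log (max (|(u : ℝ)|) (|(w : ℝ)|)) ≤ κ * (((UniqueFactorizationMonoid.radical (u * w * (u ^ 2 - 11 * u * w - w ^ 2))).natAbs : ℕ) : ℝ) ^ (ε : ℝ) * ((((UniqueFactorizationMonoid.radical (u ^ 2 - 11 * u * w - w ^ 2)).natAbs : ℕ) : ℝ) ^ (2 / 3 : ℝ) * (min (((UniqueFactorizationMonoid.radical u).natAbs : ℕ) : ℝ) (((UniqueFactorizationMonoid.radical w).natAbs : ℕ) : ℝ)) ^ (2 / 3 : ℝ))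

/-- The three-forms NF pencil bound (exponent `1/3 + ε`), = conclusion of
`NFPencilThreeForms.threeForms_of_scoones2021` = `NFPencilBound` at `k = 3`. -/
def ThreeFormsNF : Prop :=
  ∀ (K : Type) [Field K] [NumberField K], IsPrincipalIdealRing (𝓞 K) →
    ∀ (α β : Fin 3 → 𝓞 K), (∀ i j, i ≠ j → α i * β j ≠ α j * β i) → ∀ ε : ℝ, 0 < ε →
      ∃ C : ℝ, ∀ u w : ℤ, IsCoprime u w →
        (∏ i, (α i * (u : 𝓞 K) + β i * (w : 𝓞 K))) ≠ 0 →
          Real.log ((max |u| |w| : ℤ) : ℝ) ≤ C *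
            ((∏ i, Ideal.absNorm (Ideal.span {α i * (u : 𝓞 K) + β i * (w : 𝓞 K)}).radical : ℕ) : ℝ) ^
              (1 / (3 : ℝ) + ε)

theorem threeFormsNF_of_scoones2021
    (hS : Literature.NumberTheory.DiophantineGeometry.scoones2021_abcNumberField_classNumberOne) :
    ThreeFormsNF :=
  Summit.ABC.ABC.Theorems.NFPencilThreeForms.threeForms_of_scoones2021 hS

/-- The one-sided bound with third form `w` (k1's `side_w` conclusion). -/
def SideW : Prop :=
  ∀ ε : ℝ, 0 < ε → ∃ C : ℝ, ∀ u w : ℤ, IsCoprime u w →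
    u * w * (u ^ 2 - 11 * u * w - w ^ 2) ≠ 0 →
      Real.log (max (|(u : ℝ)|) (|(w : ℝ)|)) ≤ C *
        (((radical (u ^ 2 - 11 * u * w - w ^ 2)).natAbs * (radical w).natAbs : ℕ) : ℝ) ^
          (2 / 3 + ε : ℝ)

/-- The one-sided bound with third form `u` (k1's `side_u` conclusion). -/
def SideU : Prop :=
  ∀ ε : ℝ, 0 < ε → ∃ C : ℝ, ∀ u w : ℤ, IsCoprime u w →
    u * w * (u ^ 2 - 11 * u * w - w ^ 2) ≠ 0 →
      Real.log (max (|(u : ℝ)|) (|(w : ℝ)|)) ≤ C *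
        (((radical (u ^ 2 - 11 * u * w - w ^ 2)).natAbs * (radical u).natAbs : ℕ) : ℝ) ^
          (2 / 3 + ε : ℝ)

/-! ## 1. PLAN A algebra (all proved): the `k = 3` golden dictionary for the Gaussian template
`GaussianOfNFPencil.log_max_le_of_nfPencilBound` (ζ ↦ θ, 2 ↦ 5(2θ−1), u²+w² ↦ Q). -/

/-- 3-form product: `(u + β₂w)(u + β₃w)·w = Q·w` (template's `prod_forms`). -/
theorem prod_forms_w {R : Type*} [CommRing R] (θ u w β₂ β₃ : R) (h₂ : β₂ = -3 - 5 * θ)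
    (h₃ : β₃ = -8 + 5 * θ) (hθ : θ * θ = θ + 1) :
    ∏ i : Fin 3, ((![1, 1, 0] : Fin 3 → R) i * u + (![β₂, β₃, 1] : Fin 3 → R) i * w) =
      (u ^ 2 - 11 * u * w - w ^ 2) * w := by
  rw [Fin.prod_univ_three]
  simp only [Matrix.cons_val_zero, Matrix.cons_val_one, Matrix.cons_val]
  rw [h₂, h₃]
  linear_combination (-(25 : R) * w ^ 3) * hθ

/-- `(5(2θ−1))² = 125` (the constant `2` of the template has `2² = 4`; here `N(5√5) = 125`). -/
theorem sqrtFive_mul_self {R : Type*} [CommRing R] (θ : R) (hθ : θ * θ = θ + 1) :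
    (5 * (2 * θ - 1)) * (5 * (2 * θ - 1)) = (125 : R) := by
  linear_combination (100 : R) * hθ

/-- `5(2θ−1) ≠ 0` in any char-0 domain with `θ² = θ + 1` (template's `h20 : (2 : 𝓞 K) ≠ 0`). -/
theorem sqrtFive_ne_zero {R : Type*} [CommRing R] [IsDomain R] [CharZero R] (θ : R)
    (hθ : θ * θ = θ + 1) : (5 * (2 * θ - 1) : R) ≠ 0 := by
  intro h
  have h125 := sqrtFive_mul_self θ hθ
  rw [h, mul_zero] at h125
  norm_num at h125

/-- `β₂ ≠ β₃` (template's `hneg : -ζ ≠ ζ`): `β₃ − β₂ = 5(2θ−1) ≠ 0`. -/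
theorem beta_ne {R : Type*} [CommRing R] [IsDomain R] [CharZero R] (θ β₂ β₃ : R)
    (h₂ : β₂ = -3 - 5 * θ) (h₃ : β₃ = -8 + 5 * θ) (hθ : θ * θ = θ + 1) : β₂ ≠ β₃ := by
  intro h
  apply sqrtFive_ne_zero θ hθ
  rw [h₂, h₃] at h
  linear_combination (-1 : R) * h

/-- `gcd(u,w) = 1 ⇒ Q ⟂ w` (template's `isRelPrime_sq_add_sq`), by name from the golden file. -/
theorem isRelPrime_Q_w {u w : ℤ} (h : IsCoprime u w) :
    IsRelPrime (u ^ 2 - 11 * u * w - w ^ 2) w :=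
  (Summit.ABC.ABC.Theorems.GoldenFromNFPencil.isCoprime_quadForm_right h).symm.isRelPrime

/-! ## 2. PLAN A, the one NF lemma (port of the template; `sorry` = prover work, ≈ 80 lines) -/

/-- **H3 (golden side-`w` bound, template shape).** Over a class-number-one quadratic field containing
`θ` with `θ² = θ + 1`: from `ThreeFormsNF` on the forms `u + β₂w, u + β₃w, w`,
`log max(|u|,|w|) ≤ C · rad(Q·w)^{2/3+ε}` (`∏ Gᵢ ≤ N(5√5)·rad(Qw)²`, `1/3+ε/2 ↦ 2/3+ε`).
Port of `GaussianOfNFPencil.log_max_le_of_nfPencilBound` line by line. -/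
theorem goldenSideW (h3 : ThreeFormsNF) (K : Type) [Field K] [NumberField K]
    (hPID : IsPrincipalIdealRing (𝓞 K)) (θ : 𝓞 K) (hθ : θ * θ = θ + 1)
    (hdeg : Module.finrank ℚ K = 2) (ε : ℝ) (hε : 0 < ε) :
    ∃ C : ℝ, 0 ≤ C ∧ ∀ u w : ℤ, IsCoprime u w → w ≠ 0 → u ^ 2 - 11 * u * w - w ^ 2 ≠ 0 →
      Real.log ((max |u| |w| : ℤ) : ℝ) ≤
        C * (((radical ((u ^ 2 - 11 * u * w - w ^ 2) * w)).natAbs : ℕ) : ℝ) ^ (2 / 3 + ε : ℝ) := by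
  sorry

/-- H3 ⇒ k1's `side_w` shape at `K = ℚ(√5)` (`QuadraticAlgebra ℚ 1 1`, `GoldenField.*` API):
casts only (`radical_mul` + `Int.natAbs_mul`, `push_cast` on `max`). -/
theorem sideW_of_goldenSideW
    (H : ∀ (K : Type) [Field K] [NumberField K], IsPrincipalIdealRing (𝓞 K) → ∀ θ : 𝓞 K,
      θ * θ = θ + 1 → Module.finrank ℚ K = 2 → ∀ ε : ℝ, 0 < ε →
      ∃ C : ℝ, 0 ≤ C ∧ ∀ u w : ℤ, IsCoprime u w → w ≠ 0 → u ^ 2 - 11 * u * w - w ^ 2 ≠ 0 →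
        Real.log ((max |u| |w| : ℤ) : ℝ) ≤
          C * (((radical ((u ^ 2 - 11 * u * w - w ^ 2) * w)).natAbs : ℕ) : ℝ) ^ (2 / 3 + ε : ℝ)) :
    SideW := by
  intro ε hε
  haveI hfact : Fact (∀ r : ℚ, r ^ 2 ≠ (1 : ℚ) + 1 * r) := ⟨GoldenField.golden_fact⟩
  haveI : NumberField (QuadraticAlgebra ℚ (1 : ℚ) 1) := GoldenField.numberField
  obtain ⟨C, -, hC⟩ := H (QuadraticAlgebra ℚ (1 : ℚ) 1)
    GoldenField.ringOfIntegers_isPrincipalIdealRing ⟨ω, GoldenField.isIntegral_omega⟩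
    Summit.ABC.ABC.Theorems.GoldenFromNFPencil.theta_mul_theta GoldenField.finrank_eq_two ε hε
  refine ⟨C, fun u w hcop hne => ?_⟩
  have hw : w ≠ 0 := fun h => hne (by rw [h]; ring)
  have hQ : u ^ 2 - 11 * u * w - w ^ 2 ≠ 0 := fun h => hne (by rw [h]; ring)
  have h := hC u w hcop hw hQ
  rw [radical_mul (isRelPrime_Q_w hcop), Int.natAbs_mul] at h
  have hmax : ((max |u| |w| : ℤ) : ℝ) = max (|(u : ℝ)|) (|(w : ℝ)|) := by push_cast; rfl
  rw [hmax] at h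
  exact h

/-- **H3u from H3w by the symmetry `(u, w) ↦ (w, −u)`** (`Q ↦ −Q`, `uwQ` invariant, `radical_neg`,
`max_comm`): no second NF computation. PROVED. -/
theorem sideU_of_sideW (hw : SideW) : SideU := by
  intro ε hε
  obtain ⟨C, hC⟩ := hw ε hε
  refine ⟨C, fun u w hcop hne => ?_⟩
  have hcop' : IsCoprime w (-u) := hcop.symm.neg_right
  have hne' : w * (-u) * (w ^ 2 - 11 * w * (-u) - (-u) ^ 2) ≠ 0 := by
    have e : w * (-u) * (w ^ 2 - 11 * w * (-u) - (-u) ^ 2) =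
        u * w * (u ^ 2 - 11 * u * w - w ^ 2) := by ring
    rw [e]; exact hne
  have h := hC w (-u) hcop' hne'
  have hQ : w ^ 2 - 11 * w * (-u) - (-u) ^ 2 = -(u ^ 2 - 11 * u * w - w ^ 2) := by ring
  rw [hQ, radical_neg, radical_neg, Int.cast_neg, abs_neg, max_comm] at h
  exact h

/-! ## 3. PLAN B helper: third-largest norm ≤ cube root of the product (Győry 2019 `P′`-form) -/

/-- For any three distinct indices the least of their values, cubed, is at most the full product
(all values `≥ 1`): `P′_S³ ≤ N₁N₂N₃ ≤ ∏_{𝔭∈S} N𝔭`. -/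
theorem min_three_pow_le_prod {ι : Type*} [DecidableEq ι] {s : Finset ι} {f : ι → ℕ}
    (h1 : ∀ x ∈ s, 1 ≤ f x) {a b c : ι} (ha : a ∈ s) (hb : b ∈ s) (hc : c ∈ s)
    (hab : a ≠ b) (hac : a ≠ c) (hbc : b ≠ c) :
    (min (f a) (min (f b) (f c))) ^ 3 ≤ ∏ x ∈ s, f x := by
  have hsub : ({a, b, c} : Finset ι) ⊆ s := by
    intro x hx
    simp only [Finset.mem_insert, Finset.mem_singleton] at hx
    rcases hx with rfl | rfl | rfl <;> assumption
  have hm1 : min (f a) (min (f b) (f c)) ≤ f a := min_le_left _ _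
  have hm2 : min (f a) (min (f b) (f c)) ≤ f b := (min_le_right _ _).trans (min_le_left _ _)
  have hm3 : min (f a) (min (f b) (f c)) ≤ f c := (min_le_right _ _).trans (min_le_right _ _)
  calc (min (f a) (min (f b) (f c))) ^ 3
        = min (f a) (min (f b) (f c)) * (min (f a) (min (f b) (f c)) *
            min (f a) (min (f b) (f c))) := by ring
    _ ≤ f a * (f b * f c) := Nat.mul_le_mul hm1 (Nat.mul_le_mul hm2 hm3)
    _ = ∏ x ∈ ({a, b, c} : Finset ι), f x := by
        rw [Finset.prod_insert (by simp [hab, hac]), Finset.prod_insert (by simp [hbc]),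
          Finset.prod_singleton]
    _ ≤ ∏ x ∈ s, f x :=
        Finset.prod_le_prod_of_subset_of_one_le' hsub (fun x hx _ => h1 x hx)

/-! ## 4. PLAN C: the golden `P`-form (Stewart–Yu Thm 2 shape for the pencil `u, w, u²−11uw−w²`) -/

/-- `P(n)` for an integer: largest prime factor of `|n|` (`P(0) = P(±1) = 1`), tree's
`Literature.Barriers.ABC.largestPrimeFactor`. -/
def P (n : ℤ) : ℕ := largestPrimeFactor n.natAbs

/-- **GoldenPForm** — `log max(|u|,|w|) ≤ κ_δ · R^δ · min{P(u), P(w), P(Q)}` for coprime `u, w`,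
`R = rad(uwQ)`: the pencil analogue of `stewartYu2001_thm2` (`p′ = min P`, ℚ, PROVED in tree) —
member `u`/`w` via the ℚ-identities `u(u−11w) = Q + w²`, `w(11u+w) = u² − Q` (kernel `Y07Odd/Y07Two`),
member `Q` via split primes of `ℚ(√5)` with the one unit `β₃` adjoined (NOT in tree: see `Y07GoldenUnit`). -/
def GoldenPForm : Prop :=
  ∀ δ : ℝ, 0 < δ → ∃ κ : ℝ, ∀ u w : ℤ, IsCoprime u w → u * w * (u ^ 2 - 11 * u * w - w ^ 2) ≠ 0 →
    Real.log (max (|(u : ℝ)|) (|(w : ℝ)|)) ≤ κ *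
      (((radical (u * w * (u ^ 2 - 11 * u * w - w ^ 2))).natAbs : ℕ) : ℝ) ^ δ *
        ((min (P u) (min (P w) (P (u ^ 2 - 11 * u * w - w ^ 2))) : ℕ) : ℝ)

/-- The member-own bounds the tree's kernel gives NOW (from `Y07Odd`, `Y07Two` and the squaring trick of
`KummerThird.placeBound_c_of_y07At`): `log|u| ≤ κ R^δ P(u) log log H`-type, typed without the `log log`. -/
def GoldenOwnMemberBound : Prop :=
  ∀ δ : ℝ, 0 < δ → ∃ κ : ℝ, ∀ u w : ℤ, IsCoprime u w → u * w * (u ^ 2 - 11 * u * w - w ^ 2) ≠ 0 →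
    Real.log (|(u : ℝ)|) ≤ κ *
      (((radical (u * w * (u ^ 2 - 11 * u * w - w ^ 2))).natAbs : ℕ) : ℝ) ^ δ * (P u : ℝ) ∧
    Real.log (|(w : ℝ)|) ≤ κ *
      (((radical (u * w * (u ^ 2 - 11 * u * w - w ^ 2))).natAbs : ℕ) : ℝ) ^ δ * (P w : ℝ)

/-- **The missing kernel statement (p-adic half):** `Y07Odd` with ONE fixed quadratic unit `λ`
(root of `X² + 11X − 1`, i.e. `β₃ = −8 + 5θ`) adjoined, at primes `p ∤ 10` where `λ ∈ ℤ_p` (= `p` split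
in `ℚ(√5)`): `ord_p(λ^{e₀} ∏ q^{e_q} − 1)·log p < c^{#S+1} (p/log p)(log p + log B + log log A) ∏ log q`. -/
def Y07GoldenUnit : Prop :=
  ∃ c₆ : ℝ, ∀ (p : ℕ) [Fact p.Prime], p ≠ 2 → p ≠ 5 → ∀ (lam : ℤ_[p]), lam ^ 2 + 11 * lam - 1 = 0 →
    ∀ (S : Finset ℕ), (∀ q ∈ S, q.Prime) → p ∉ S → S.Nonempty → ∀ (e : ℕ → ℤ) (e₀ : ℤ) (B : ℝ),
      3 ≤ B → (∀ q ∈ S, (|e q| : ℝ) ≤ B) → (|e₀| : ℝ) ≤ B →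
      (lam : ℚ_[p]) ^ e₀ * (∏ q ∈ S, (q : ℚ_[p]) ^ e q) - 1 ≠ 0 →
        ((((lam : ℚ_[p]) ^ e₀ * (∏ q ∈ S, (q : ℚ_[p]) ^ e q) - 1).valuation : ℤ) : ℝ) * Real.log p <
          c₆ ^ (S.card + 1) * ((p : ℝ) / Real.log p) *
            (Real.log p + Real.log B + Real.log (Real.log ((max 4 (S.sup id) : ℕ) : ℝ))) *
            ∏ q ∈ S, Real.log (q : ℝ)

/-- `5`-adic bookkeeping (elementary): for coprime `u, w`, `5⁴ ∤ u² − 11uw − w²`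
(`ord_{√5}(u + β₂w) ∈ {0, 2, 3}`), so the ramified prime never needs a linear form. -/
theorem pow_five_four_not_dvd_Q {u w : ℤ} (h : IsCoprime u w) :
    ¬ ((5 : ℤ) ^ 4 ∣ u ^ 2 - 11 * u * w - w ^ 2) := by
  sorry

/-- Payoff 1: the `P`-form gives the registered stub (`min{P u, P w, P Q} ≤ min(q, m) ≤ q^{2/3} m^{2/3}`,
`q = rad Q ≥ 1`, `m = min(rad u, rad w) ≥ 1`). Real arithmetic only. -/
theorem sig_of_goldenPForm (h : GoldenPForm) : Sig := by
  sorry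

/-- Payoff 2: the `P`-form gives the CRUX with exponent `1/3 + ε` (better than the thesis' `1/2`):
`min{P u, P w, P Q}³ ≤ P(u)P(w)P(Q) ≤ rad u · rad w · rad Q = R`. -/
theorem goldenCuspShadow_third_of_goldenPForm (h : GoldenPForm) :
    ∀ ε : ℝ, 0 < ε → ∃ κ : ℝ, ∀ u w : ℤ, IsCoprime u w → u * w * (u ^ 2 - 11 * u * w - w ^ 2) ≠ 0 →
      Real.log (max (|(u : ℝ)|) (|(w : ℝ)|)) ≤ κ *
        (((radical (u * w * (u ^ 2 - 11 * u * w - w ^ 2))).natAbs : ℕ) : ℝ) ^ (1 / 3 + ε : ℝ) := by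
  sorry

/-- … hence `GoldenCuspShadow` itself (`R^{1/3+ε} ≤ R^{1/2+ε}`, `R ≥ 1`). -/
theorem goldenCuspShadow_of_goldenPForm (h : GoldenPForm) :
    Summit.ABC.ABC.Theses.CuspFieldPencil.GoldenCuspShadow := by
  sorry

end Summit.ABC.ABC.Cruxes.GoldenCuspShadow.SideaK1G2
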